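import Literature.RepresentationTheory.BorelWallach2000.UpqComplexSpan
import Literature.RepresentationTheory.BorelWallach2000.UpqHodgeBigrading
import Literature.NumberTheory.Automorphic.GKModulesAdmissibleOfEigenspaces
import Summits.HodgeConjecture.HodgeConjecture.Theorems.F0P3bU21Coordinates
import HarnessLib

/-!
# FLOOR-0 P3b «ENGINE local packets», line `F0_LocalAPackets` — GENERIC `kovLie` TRANSPORTS (brick B2, Kovačević-free half of W2):
# irreducibility and admissibility of `(kovLie ρ, ρK)` from `𝔤𝔩(3, ℂ)`-module data

Cell hodgecm-mathlib (D-0151), FLOOR 0, crux item H413 = stmt-HodgeConjecture-24833; sub-line `Cruxes/H413/Lines/F0_LocalAPackets.lean`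
(F0P3b-plan (g5), edition 4, waypoint W2 of T3a₁; row B2 GO 2026-08-31T03:50:43Z).  Author A-p10 (g17).  PROOF lane (theorems only: no `def`,
no `sorry`, no instance declaration, no notation, no named fact).  Imports ★ K0 `BorelWallach2000/UpqComplexSpan`, ★ `BorelWallach2000/UpqHodgeBigrading`
(`upqZ0`, `upqZ0_mem_kInLie`), ★ FILE A `Automorphic/GKModulesAdmissibleOfEigenspaces`, ★ (w4g) `Theorems/F0P3bU21Coordinates` (+ transitively
(w3g) `Theorems/F0P3bU21Restriction`: `kovLie`, `kovLie_apply`; the defs leaf `Theorems/F0P3bLocalAPacketsDefs`: `G21`) — NEVER the Lines module;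
not on the R2 reverse cone.

For a GENERIC complex-linear `𝔤𝔩(3, ℂ)`-action `ρ` on `V` and its honest `𝔲(2,1)`-action `kovLie ρ` (★ `kovLie_apply`: `kovLie ρ X = ρ (reindex X)`):
* §1 **`isIrreducibleGK_kovLie_of_forall_submodule`** — if `V ≠ 0` and the only `ρ`-stable complex subspaces are `⊥`, `⊤`, then `(ρK, kovLie ρ)` is an
  irreducible `(𝔤, K)`-module for EVERY `K`-action `ρK` (★ K0 `upq_isIrreducibleGK_of_forall_submodule` with `f = ρ ∘ reindex`; `reindex` is onto).
* §2 **`isAdmissibleGK_kovLie_of_weightBasis`** — if `ρ 1 = 0` (Kovačević's `𝔰𝔩(3)`-normalisation ★ `ρfun_one`) and `V` has a basis of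
  `ρ(Z)`-eigenvectors, `Z = E₀₀ + E₁₁ − 2E₂₂` (Kovačević's `Z = H_α + 2H_β`), `ρ Z (b i) = m i • b i`, with FINITE fibres `{i | m i = m₀}`, then every
  `K`-action `ρK` compatible with `kovLie ρ` (`IsGKModule G21 ρK (kovLie ρ)`) is admissible: `z₀ = diag(i, i | 0) ∈ 𝔨` (★ `upqZ0_mem_kInLie`) acts by
  `kovLie ρ z₀ = (i∕3) ρ Z` (★ (w4g) `kovLie_upqZ0_of_map_one`), so `b` is an eigenbasis of an element of the `𝔨`-algebra with finite fibres ⇒ ★ FILE A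
  `IsGKModule.isAdmissibleGK_of_basis_eigenvector`.  (Explicit `K`-type data «`V = ⨁ V_{n,m}`, `Z` acts on `V_{n,m}` by `m`» satisfy this iff
  `{n | (n, m) ∈ S}` is finite for each `m` — every Kovačević ray, in particular the ladder `Z(3)` where `m = 3n − 3`.)
The τ1-gated closer `Theorems/F0P3bKovacevicTransports.lean` (W2 + W3 for `ladderPlus` VERBATIM) applies §1–§2 to ★ `ladderPlus_isIrreducible`,
★ `lie_Z_vec`, ★ `mem_ladderPlus`.

HONEST LABEL: HC_CM is proved only modulo the 7 printed citations until rung 0 closes; this is ONE helper file of ONE floor-0 sub-line.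

## References
* [Kovacevic2021] D. Kovačević, *Unitary `(𝔤, K)`-modules of `SU(2,1)`*, Acta Math. Spalatensia 1 (2021) — §3 Def 1 (`Z = H_α + 2H_β` acts on `V_{n,m}`
  by `m`), Thm 3; §4 Thm 5.
* [BorelWallach2000] A. Borel, N. Wallach, *Continuous Cohomology, Discrete Subgroups, and Representations of Reductive Groups*, 2nd ed., AMS 2000 —
  0 §2.4–2.5, II §4.1.
* [KnappVogan1995] A. W. Knapp, D. A. Vogan, *Cohomological Induction and Unitary Representations* (1995) — §I.3 (before Prop. 1.63), §II.4.
-/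

set_option autoImplicit false
set_option linter.dupNamespace false

noncomputable section

namespace Summit.HodgeConjecture.HodgeConjecture.Cruxes.H413.F0P3bKovLieTransports

open Literature.NumberTheory.Automorphic
open Literature.RepresentationTheory.BorelWallach2000
open Literature.RepresentationTheory.KonnoKonno2007 Literature.RepresentationTheory.KonnoKonno2007.RealDualPair
open Literature.RepresentationTheory.KonnoKonno2007.RealDualPair.UForm
open Summit.HodgeConjecture.HodgeConjecture.Cruxes.H413.F0P3bLocalAPacketsDefs
open Summit.HodgeConjecture.HodgeConjecture.Cruxes.H413.F0P3bU21Restriction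
open Summit.HodgeConjecture.HodgeConjecture.Cruxes.H413.F0P3bU21Coordinates

-- Mathlib idiom (as in `GKModules`, the `Upq*` files, the defs leaf, (w3g), (w4g) and the line): commutator bracket on `Module.End` ∕ matrices
attribute [local instance 100] LieRing.ofAssociativeRing

variable {V : Type} [AddCommGroup V] [Module ℂ V] (ρ : Matrix (Fin 3) (Fin 3) ℂ →ₗ⁅ℂ⁆ Module.End ℂ V)

/-! ## §1 Irreducibility of `(ρK, kovLie ρ)` from `ρ`-irreducibility -/

/-- **Irreducibility transport for `kovLie`.**  If `V ≠ 0` and the only complex subspaces stable under every `ρ M`, `M ∈ 𝔤𝔩(3, ℂ)`, are `⊥`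
and `⊤`, then `(ρK, kovLie ρ)` is an irreducible `(𝔤, K)`-module of `U(2,1)` for every `K`-action `ρK` (a `(𝔤, K)`-submodule is `kovLie ρ`-stable,
and the complex span of `reindex 𝔲(2,1)` is `𝔤𝔩(3, ℂ)` — ★ K0). [cite: KnappVogan1995, §II.4 (after Cor. 2.78); Kovacevic2021, §3 Thm 3] -/
theorem isIrreducibleGK_kovLie_of_forall_submodule [Nontrivial V]
    (hirr : ∀ W : Submodule ℂ V, (∀ (M : Matrix (Fin 3) (Fin 3) ℂ), ∀ w ∈ W, ρ M w ∈ W) → W = ⊥ ∨ W = ⊤)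
    (ρK : Representation ℂ G21.maximalCompact V) : IsIrreducibleGK ρK (kovLie ρ) := by
  let e : Matrix (Fin 2 ⊕ Fin 1) (Fin 2 ⊕ Fin 1) ℂ ≃ₗ[ℂ] Matrix (Fin 3) (Fin 3) ℂ :=
    Matrix.reindexLinearEquiv ℂ ℂ (finSumFinEquiv : Fin 2 ⊕ Fin 1 ≃ Fin 3) (finSumFinEquiv : Fin 2 ⊕ Fin 1 ≃ Fin 3)
  refine upq_isIrreducibleGK_of_forall_submodule ρK (kovLie ρ)
    ((ρ : Matrix (Fin 3) (Fin 3) ℂ →ₗ⁅ℂ⁆ Module.End ℂ V).toLinearMap ∘ₗ e.toLinearMap) (fun X => rfl) fun W hW => hirr W fun M w hw => ?_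
  have h := hW (e.symm M) w hw
  rw [LinearMap.comp_apply, LinearEquiv.coe_coe, LinearEquiv.apply_symm_apply] at h
  exact h

/-! ## §2 Admissibility of every compatible `K`-action from a `Z`-eigenbasis with finite fibres -/

/-- **`z₀ ∈ 𝔨` as an element of `G21.compactLie`** (★ `upqZ0_mem_kInLie`, `kInLie = range (𝔨 ↪ 𝔤)`). [cite: BorelWallach2000, II §4.1] -/
theorem exists_compactLie_eq_upqZ0 :
    ∃ z₀ : G21.compactLie, LieSubalgebra.inclusion G21.compactLie_le_lie z₀ = upqZ0 (Fin 2) (Fin 1) :=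
  (LieHom.mem_range _ _).1 (upqZ0_mem_kInLie (α := Fin 2) (β := Fin 1))

/-- `kovLie ρ z₀` lies in the subalgebra of `End V` generated by `kovLie ρ (𝔨)`. [cite: BorelWallach2000, 0 §2.5] -/
theorem kovLie_upqZ0_mem_adjoin :
    kovLie ρ (upqZ0 (Fin 2) (Fin 1)) ∈
      Algebra.adjoin ℂ (Set.range fun Y : G21.compactLie => kovLie ρ (LieSubalgebra.inclusion G21.compactLie_le_lie Y)) := by
  obtain ⟨z₀, hz₀⟩ := exists_compactLie_eq_upqZ0
  rw [← hz₀]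
  exact Algebra.subset_adjoin ⟨z₀, rfl⟩

/-- **Admissibility transport for `kovLie` from a `Z`-eigenbasis with finite fibres.**  Let `ρ` kill the identity (`ρ 1 = 0`) and let `b` be a
basis of `V` with `ρ Z (b i) = m i • b i`, `Z = E₀₀ + E₁₁ − 2E₂₂`, every value `m₀` being taken by finitely many `i`.  Then every `K`-action `ρK`
with `IsGKModule G21 ρK (kovLie ρ)` is admissible: `kovLie ρ z₀ = (i∕3) ρ Z` (★ (w4g)) is an element of the `𝔨`-algebra with eigenbasis `b`,
eigenvalues `(i∕3) m i` and the same (finite) fibres ⇒ ★ FILE A `isAdmissibleGK_of_basis_eigenvector`.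
[cite: KnappVogan1995, §I.3 (before Prop. 1.63); BorelWallach2000, 0 §2.4; Kovacevic2021, §3 Def 1] -/
theorem isAdmissibleGK_kovLie_of_weightBasis (hρ1 : ρ 1 = 0) {ι : Type*} (b : Module.Basis ι ℂ V) (m : ι → ℂ)
    (hb : ∀ i, ρ (Matrix.single 0 0 1 + Matrix.single 1 1 1 - (2 : ℂ) • Matrix.single 2 2 1) (b i) = m i • b i)
    (hfib : ∀ m₀ : ℂ, Set.Finite {i | m i = m₀})
    {ρK : Representation ℂ G21.maximalCompact V} (hgk : IsGKModule G21 ρK (kovLie ρ)) : IsAdmissibleGK ρK := by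
  have hI : (Complex.I / 3 : ℂ) ≠ 0 := div_ne_zero Complex.I_ne_zero (by norm_num)
  refine hgk.isAdmissibleGK_of_basis_eigenvector (kovLie_upqZ0_mem_adjoin ρ) b (fun i => Complex.I / 3 * m i)
    (fun i => ?_) (fun c₀ => ?_)
  · rw [kovLie_upqZ0_of_map_one ρ hρ1, LinearMap.smul_apply, hb, smul_smul]
  · have hset : {i | Complex.I / 3 * m i = c₀} ⊆ {i | m i = (Complex.I / 3)⁻¹ * c₀} := fun i hi => by
      simp only [Set.mem_setOf_eq] at hi ⊢
      rw [← hi, ← mul_assoc, inv_mul_cancel₀ hI, one_mul]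
    exact (hfib _).subset hset

end Summit.HodgeConjecture.HodgeConjecture.Cruxes.H413.F0P3bKovLieTransports
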